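import Summits.QuantumFields.YangMills.Theses.PencilRigidity
import Literature.NumberTheory.LFunctions.DeBruijnNewmanProofs

/-!
# `stub_fourierVanish` is sharp at `σ = 8` (crux `ShellRigidity`, stmt-QuantumFields-11685)

Refuter lineage `cdisprove-stmt-QuantumFields-11685`, cycle 3 (seat `…-g3-0`, 2026-08-16).

Lead skeleton v3 (`Cruxes/ShellRigidity/Lines/transverse-smearing-planar-threshold.lean`, sha 787c769ac739)
splits the planar angular-rigidity step into `stub_angularChart` + `stub_fourierVanish`; the latter says:
a continuous `π/2`-periodic `g : ℝ → ℂ` admitting, for every depth `Ψ > 0`, a chart `h` holomorphic on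
the rectangle `{|Re w| < 3π/8, |Im w| < Ψ}`, equal to `g` at its real points, with equal values on the
vertical lines `Re w = ±π/4`, and of exponential type `‖h w‖ ≤ A + B e^{σ|Im w|}` with **`σ < 8`**, is a
trigonometric polynomial `c₀ + c₁ e^{4ix} + c₂ e^{-4ix}`.

Here (`not_fourierVanish_le8`): the order hypothesis cannot be relaxed to `σ ≤ 8` — the statement with
`σ ≤ 8`, everything else verbatim, is false. Witness `g(x) = cos 8x` (the pure mode `n = ±2`), chart
`h(w) = cos 8w` (entire, `π/2`-periodic, `‖cos 8w‖ ≤ e^{8|Im w|}` so `A = 0`, `B = 1`, `σ = 8`), and `cos 8x`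
is not of the form `c₀ + c₁e^{4ix} + c₂e^{-4ix}` (evaluate at `x = 0, π/4, π/8, -π/8`: the first pair forces
`c₀ = 1`, the second `c₀ = -1`). This is the one-variable core of the planar threshold
(`Negative/PlanarThresholdSharp.lean`: `cos 8φ / r⁸`); it certifies that `σ < 8` in the registered sub-lemma
is load-bearing and gives its worker a test case (the contour bound `(A + Be^{σ|ψ|})e^{−4|n||ψ|}` is attained
by `n = ±2`). No definition is introduced and no Theses declaration is asserted positively; the bound
`‖cos w‖ ≤ e^{|Im w|}` is the tree's `Literature.NumberTheory.LFunctions.norm_cos_le_exp_abs_im`.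
-/

namespace Summit.QuantumFields.YangMills.Theorems.ShellRigidity.Negative

open Complex

noncomputable section

/-- `x ↦ cos 8x` (as a complex-valued function of a real variable) is `π/2`-periodic. [folklore] -/
theorem periodic_cos_eight : Function.Periodic (fun x : ℝ => Complex.cos (8 * (x : ℂ))) (Real.pi / 2) := by
  intro x
  simp only []
  have : (8 : ℂ) * (((x + Real.pi / 2 : ℝ)) : ℂ) = 8 * (x : ℂ) + (2 : ℕ) * (2 * Real.pi) := by
    push_cast; ring
  rw [this, Complex.cos_add_nat_mul_two_pi]

/-- The vertical-line condition for the chart `cos 8w`: `cos (2π + 8iy) = cos (-2π + 8iy)`. [folklore] -/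
theorem cos_eight_vertical (y : ℝ) :
    Complex.cos (8 * ((((Real.pi / 4 : ℝ)) : ℂ) + y * I)) =
      Complex.cos (8 * ((((-(Real.pi / 4) : ℝ)) : ℂ) + y * I)) := by
  have h1 : (8 : ℂ) * ((((Real.pi / 4 : ℝ)) : ℂ) + y * I) = 8 * (y : ℂ) * I + (1 : ℕ) * (2 * Real.pi) := by
    push_cast; ring
  have h2 : (8 : ℂ) * ((((-(Real.pi / 4) : ℝ)) : ℂ) + y * I) = 8 * (y : ℂ) * I - (1 : ℕ) * (2 * Real.pi) := by
    push_cast; ring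
  rw [h1, h2, Complex.cos_add_nat_mul_two_pi, Complex.cos_sub_nat_mul_two_pi]

/-- The type bound of the chart with `σ = 8`, `A = 0`, `B = 1`: `‖cos 8w‖ ≤ 0 + 1·e^{8|Im w|}`. [folklore] -/
theorem norm_cos_eight_le (w : ℂ) : ‖Complex.cos (8 * w)‖ ≤ 0 + 1 * Real.exp (8 * |w.im|) := by
  have := Literature.NumberTheory.LFunctions.norm_cos_le_exp_abs_im (8 * w)
  have him : |(8 * w).im| = 8 * |w.im| := by
    simp [abs_mul]
  rw [him] at this
  linarith

/-- `cos 8x` satisfies the chart hypotheses of the relaxed stub with `σ = 8`, `A = 0`, `B = 1`, the chart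
being the entire function `cos 8w` for every depth `Ψ`. [folklore] -/
theorem cos_eight_charts : ∀ Ψ : ℝ, 0 < Ψ → ∃ h : ℂ → ℂ,
    DifferentiableOn ℂ h {w : ℂ | |w.re| < 3 * Real.pi / 8 ∧ |w.im| < Ψ} ∧
    (∀ α : ℝ, |α| < 3 * Real.pi / 8 → h α = (fun x : ℝ => Complex.cos (8 * (x : ℂ))) α) ∧
    (∀ y : ℝ, |y| < Ψ → h (((Real.pi / 4 : ℝ) : ℂ) + y * I) = h (((-(Real.pi / 4) : ℝ) : ℂ) + y * I)) ∧
    (∀ w : ℂ, |w.re| < 3 * Real.pi / 8 → |w.im| < Ψ → ‖h w‖ ≤ 0 + 1 * Real.exp (8 * |w.im|)) :=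
  fun _ _ => ⟨fun w => Complex.cos (8 * w),
    (Complex.differentiable_cos.comp (differentiable_id.const_mul (8 : ℂ))).differentiableOn,
    fun _ _ => rfl, fun y _ => cos_eight_vertical y, fun w _ _ => norm_cos_eight_le w⟩

/-- `cos 8x` is not a trigonometric polynomial of degree `≤ 1` in `e^{4ix}` (values at `0, π/4, ±π/8`).
[folklore] -/
theorem cos_eight_not_span (c₀ c₁ c₂ : ℂ)
    (h : ∀ x : ℝ, Complex.cos (8 * (x : ℂ)) =
      c₀ + c₁ * cexp (4 * (x : ℂ) * I) + c₂ * cexp (-(4 * (x : ℂ) * I))) : False := by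
  have e0 := h 0
  have e1 := h (Real.pi / 4)
  have e2 := h (Real.pi / 8)
  have e3 := h (-(Real.pi / 8))
  -- values of `cos 8x`
  have g0 : Complex.cos (8 * ((0 : ℝ) : ℂ)) = 1 := by simp
  have g1 : Complex.cos (8 * (((Real.pi / 4 : ℝ)) : ℂ)) = 1 := by
    have : (8 : ℂ) * (((Real.pi / 4 : ℝ)) : ℂ) = 0 + (1 : ℕ) * (2 * Real.pi) := by push_cast; ring
    rw [this, Complex.cos_add_nat_mul_two_pi, Complex.cos_zero]
  have g2 : Complex.cos (8 * (((Real.pi / 8 : ℝ)) : ℂ)) = -1 := by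
    have : (8 : ℂ) * (((Real.pi / 8 : ℝ)) : ℂ) = Real.pi := by push_cast; ring
    rw [this, Complex.cos_pi]
  have g3 : Complex.cos (8 * (((-(Real.pi / 8) : ℝ)) : ℂ)) = -1 := by
    have : (8 : ℂ) * (((-(Real.pi / 8) : ℝ)) : ℂ) = -Real.pi := by push_cast; ring
    rw [this, Complex.cos_neg, Complex.cos_pi]
  -- values of the exponentials
  have x0 : cexp (4 * ((0 : ℝ) : ℂ) * I) = 1 := by simp
  have x0' : cexp (-(4 * ((0 : ℝ) : ℂ) * I)) = 1 := by simp
  have x1 : cexp (4 * (((Real.pi / 4 : ℝ)) : ℂ) * I) = -1 := by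
    have : 4 * (((Real.pi / 4 : ℝ)) : ℂ) * I = Real.pi * I := by push_cast; ring
    rw [this, Complex.exp_pi_mul_I]
  have x1' : cexp (-(4 * (((Real.pi / 4 : ℝ)) : ℂ) * I)) = -1 := by
    have : -(4 * (((Real.pi / 4 : ℝ)) : ℂ) * I) = -(Real.pi * I) := by push_cast; ring
    rw [this, Complex.exp_neg, Complex.exp_pi_mul_I]
    norm_num
  have x2 : cexp (4 * (((Real.pi / 8 : ℝ)) : ℂ) * I) = I := by
    have : 4 * (((Real.pi / 8 : ℝ)) : ℂ) * I = Real.pi / 2 * I := by push_cast; ring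
    rw [this, Complex.exp_pi_div_two_mul_I]
  have x2' : cexp (-(4 * (((Real.pi / 8 : ℝ)) : ℂ) * I)) = -I := by
    have : -(4 * (((Real.pi / 8 : ℝ)) : ℂ) * I) = -(Real.pi / 2 * I) := by push_cast; ring
    rw [this, Complex.exp_neg, Complex.exp_pi_div_two_mul_I, Complex.inv_I]
  have x3 : cexp (4 * (((-(Real.pi / 8) : ℝ)) : ℂ) * I) = -I := by
    have : 4 * (((-(Real.pi / 8) : ℝ)) : ℂ) * I = -(Real.pi / 2 * I) := by push_cast; ring
    rw [this, Complex.exp_neg, Complex.exp_pi_div_two_mul_I, Complex.inv_I]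
  have x3' : cexp (-(4 * (((-(Real.pi / 8) : ℝ)) : ℂ) * I)) = I := by
    have : -(4 * (((-(Real.pi / 8) : ℝ)) : ℂ) * I) = Real.pi / 2 * I := by push_cast; ring
    rw [this, Complex.exp_pi_div_two_mul_I]
  rw [g0, x0, x0'] at e0
  rw [g1, x1, x1'] at e1
  rw [g2, x2, x2'] at e2
  rw [g3, x3, x3'] at e3
  -- e0 + e1 : 2 = 2 c₀ ; e2 + e3 : -2 = 2 c₀
  have hsum : (2 : ℂ) = -2 := by
    calc (2 : ℂ) = (c₀ + c₁ * 1 + c₂ * 1) + (c₀ + c₁ * -1 + c₂ * -1) := by rw [← e0, ← e1]; norm_num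
      _ = (c₀ + c₁ * I + c₂ * -I) + (c₀ + c₁ * -I + c₂ * I) := by ring
      _ = -1 + -1 := by rw [← e2, ← e3]
      _ = -2 := by norm_num
  norm_num at hsum

/-- **`stub_fourierVanish` is sharp at `σ = 8`.** The registered stub of lead skeleton v3 with its order
hypothesis `σ < 8` RELAXED to `σ ≤ 8` (everything else verbatim) is false: `g = cos 8x` with the entire chart
`cos 8w` (`‖cos 8w‖ ≤ e^{8|Im w|}`) satisfies every hypothesis with `σ = 8` and is the pure mode `n = ±2`.
[folklore] -/
theorem not_fourierVanish_le8 :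
    ¬ (∀ (g : ℝ → ℂ), Continuous g → Function.Periodic g (Real.pi / 2) →
        ∀ (σ A B : ℝ), σ ≤ 8 →
        (∀ Ψ : ℝ, 0 < Ψ → ∃ h : ℂ → ℂ,
          DifferentiableOn ℂ h {w : ℂ | |w.re| < 3 * Real.pi / 8 ∧ |w.im| < Ψ} ∧
          (∀ α : ℝ, |α| < 3 * Real.pi / 8 → h α = g α) ∧
          (∀ y : ℝ, |y| < Ψ →
            h (((Real.pi / 4 : ℝ) : ℂ) + y * I) = h (((-(Real.pi / 4) : ℝ) : ℂ) + y * I)) ∧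
          (∀ w : ℂ, |w.re| < 3 * Real.pi / 8 → |w.im| < Ψ → ‖h w‖ ≤ A + B * Real.exp (σ * |w.im|))) →
        ∃ c₀ c₁ c₂ : ℂ, ∀ x : ℝ,
          g x = c₀ + c₁ * cexp (4 * (x : ℂ) * I) + c₂ * cexp (-(4 * (x : ℂ) * I))) := by
  intro hFV
  have hcont : Continuous fun x : ℝ => Complex.cos (8 * (x : ℂ)) := by fun_prop
  obtain ⟨c₀, c₁, c₂, hc⟩ := hFV _ hcont periodic_cos_eight 8 0 1 le_rfl cos_eight_charts
  exact cos_eight_not_span c₀ c₁ c₂ hc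

end

end Summit.QuantumFields.YangMills.Theorems.ShellRigidity.Negative
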